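import Mathlib
import HarnessLib
import Summits.Ventures.LatticeQCDFlow.Exactness.SphereFlowLiouvilleMeasure

/-!
# The mean Metropolis acceptance of an independence sampler on the lattice of spheres: closed form `∫∫e^{−max(F,F')}dπ̄dπ̄/∫e^{−F}dπ̄` and the floor `acc ≥ exp(−(a + √(v/2)))` from an exponential-moment bound `a` and a variance bound `v` of the log-weight

HONEST FRAMING: exact (Metropolis-corrected) sampling algorithms for lattice gauge theory;
figures of merit are autocorrelation/cost numbers at stated couplings and volumes; no
continuum-physics claim.

Venture `LatticeQCDFlow` (cell pub-lqcd), topic `Exactness`; FANOUT row 7 (`s0-cpn-null`: the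
S0-D1 rung — 2D CP⁹, Lüscher's LO trivializing map inside HMC, Engel–Schaefer 2011).  NEW WORK of
the cell over GEN-15's `Exactness/SphereFlowLiouvilleMeasure.lean` (`integral_spherePi_tilted`) and
the tree's `Exactness/LatticeCoordAvg.lean` (integrability of continuous functionals on the compact
product); nothing is cited as a fact.  Printed counterpart, NAMED ONLY: the flow-based independence
Metropolis sampler of M. S. Albergo, G. Kanwar, P. E. Shanahan, Phys. Rev. D 100 (2019) 034515, §II
(accept `y = Φ(ω')`, `ω' ∼ π̄`, with probability `min(1, w(ω')/w(ω))`, `w = e^{−F}`); lean-2's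
`Scaling/Acceptance.lean` has the acceptance–total-variation sandwich on FINITE state spaces.  THIS
FILE is the generic continuous-configuration-space part; the instance for the exact leading-order
flow of the lattice CP(N−1)/O(N) action is the sequel `Exactness/SphereLOFlowAcceptance.lean`.

## Setting

`π̄ = ⊗_Λ σ̄` on `Ω = S(E)^Λ`; a continuous log-weight `F` on `Ω`; the independence sampler with
target `π̄.tilted(−F)`, proposal `π̄`, acceptance `min(1, e^{F(ω) − F(ω')})`; its MEAN ACCEPTANCE AT
STATIONARITY `acc = ∫ (∫ min(1, e^{F(ω) − F(ω')}) dπ̄(ω')) d(π̄.tilted(−F))(ω)`.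

## Content

* §1 `exp_integral_le_integral_exp` (Jensen for `exp` by the tangent line), `sq_integral_abs_le_integral_sq`.
* §2 the pair functional of a continuous `F` on a compact metric probability space `(Y, ν)`:
  `integral_integral_sq_sub` (`∫∫(F(y) − F(y'))² = 2·Var(F)`), `integral_integral_abs_sub_le`
  (`∫∫|F(y) − F(y')| ≤ √(2·Var F)`), `integral_integral_max_eq`,
  **`exp_neg_le_integral_integral_exp_neg_max`** (`∫∫ e^{−max(F(y),F(y'))} ≥ exp(−(E F + ½∫∫|F(y) − F(y')|))`).
* §3 **`indepSampler_meanAccept_eq`** — `acc = (∫∫ e^{−max(F(ω),F(ω'))} dπ̄ dπ̄)/(∫ e^{−F} dπ̄)`;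
  **`exp_neg_le_meanAccept_of_mgf_of_variance`** — for ANY continuous `F` with
  `∫e^{−(F − E F)} ≤ e^{a}` and `Var F ≤ v`: `acc ≥ exp(−(a + √(v/2)))`.

NOT CLAIMED: upper bounds on the acceptance; autocorrelation times; anything model-specific.
-/

noncomputable section

namespace Summit.Ventures.LatticeQCDFlow.Exactness

open Function Set Metric MeasureTheory NormedSpace InnerProductSpace
open scoped RealInnerProductSpace Topology

/-! ## §1 Two probability-space lemmas -/

section Prob

variable {α : Type*} [MeasurableSpace α] {ν : Measure α} [IsProbabilityMeasure ν]

/-- **Jensen for the exponential, by the tangent line**: `exp(∫Y) ≤ ∫ exp(Y)` on a probability space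
(`e^y ≥ e^a(1 + y − a)` at `a = ∫Y`). -/
theorem exp_integral_le_integral_exp {Y : α → ℝ} (hY : Integrable Y ν)
    (hexp : Integrable (fun x => Real.exp (Y x)) ν) :
    Real.exp (∫ x, Y x ∂ν) ≤ ∫ x, Real.exp (Y x) ∂ν := by
  set a : ℝ := ∫ x, Y x ∂ν with ha
  have hi1 : Integrable (fun x => Y x - a) ν := hY.sub (integrable_const a)
  have hi2 : Integrable (fun x => 1 + (Y x - a)) ν := (integrable_const (1 : ℝ)).add hi1
  have hlin : Integrable (fun x => Real.exp a * (1 + (Y x - a))) ν := hi2.const_mul (Real.exp a)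
  have hpt : ∀ x, Real.exp a * (1 + (Y x - a)) ≤ Real.exp (Y x) := by
    intro x
    have h := Real.add_one_le_exp (Y x - a)
    calc Real.exp a * (1 + (Y x - a)) ≤ Real.exp a * Real.exp (Y x - a) :=
          mul_le_mul_of_nonneg_left (by linarith) (Real.exp_pos a).le
      _ = Real.exp (Y x) := by rw [← Real.exp_add]; congr 1; ring
  have hI : ∫ x, Real.exp a * (1 + (Y x - a)) ∂ν = Real.exp a := by
    rw [integral_const_mul, integral_add (integrable_const _) hi1, integral_sub hY (integrable_const a),
      integral_const, integral_const]
    simp only [smul_eq_mul, probReal_univ, one_mul, ← ha, sub_self, add_zero, mul_one]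
  calc Real.exp a = ∫ x, Real.exp a * (1 + (Y x - a)) ∂ν := hI.symm
    _ ≤ ∫ x, Real.exp (Y x) ∂ν := integral_mono hlin hexp hpt

/-- **`(∫|H|)² ≤ ∫ H²`** on a probability space (the variance of `|H|` is nonnegative). -/
theorem sq_integral_abs_le_integral_sq {H : α → ℝ} (h1 : Integrable H ν)
    (h2 : Integrable (fun x => H x ^ 2) ν) :
    (∫ x, |H x| ∂ν) ^ 2 ≤ ∫ x, H x ^ 2 ∂ν := by
  set c : ℝ := ∫ x, |H x| ∂ν with hc
  have habs : Integrable (fun x => |H x|) ν := h1.abs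
  have hq : Integrable (fun x => H x ^ 2 - 2 * c * |H x|) ν := h2.sub (habs.const_mul _)
  have h0 : 0 ≤ ∫ x, (|H x| - c) ^ 2 ∂ν := integral_nonneg fun x => sq_nonneg _
  have e : ∀ x, (|H x| - c) ^ 2 = H x ^ 2 - 2 * c * |H x| + c ^ 2 := by
    intro x; rw [sub_sq, sq_abs]; ring
  simp_rw [e] at h0
  rw [integral_add hq (integrable_const _), integral_sub h2 (habs.const_mul _), integral_const_mul,
    integral_const] at h0
  simp only [smul_eq_mul, probReal_univ, one_mul, ← hc] at h0
  nlinarith [h0]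

end Prob

/-! ## §2 The pair functional of a continuous function on a compact probability space -/

section Pair

variable {Y : Type*} [MetricSpace Y] [CompactSpace Y] [MeasurableSpace Y] [BorelSpace Y]
  (ν : Measure Y) [IsProbabilityMeasure ν] {F : Y → ℝ}

/-- Continuous functions on the compact space are integrable. -/
theorem integrable_of_continuous_compact {G : Y → ℝ} (hG : Continuous G) : Integrable G ν :=
  hG.integrable_of_hasCompactSupport (HasCompactSupport.of_compactSpace G)

/-- **`∫∫ (F(y) − F(y'))² = 2·∫(F − ∫F)²`** (iterated integrals, continuous `F`). -/
theorem integral_integral_sq_sub (hF : Continuous F) :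
    ∫ y, ∫ y', (F y - F y') ^ 2 ∂ν ∂ν = 2 * ∫ y, (F y - ∫ z, F z ∂ν) ^ 2 ∂ν := by
  set m : ℝ := ∫ z, F z ∂ν with hm
  have hFi : Integrable F ν := integrable_of_continuous_compact ν hF
  have hcm : Integrable (fun y => F y - m) ν := hFi.sub (integrable_const m)
  have hsq : Integrable (fun y => (F y - m) ^ 2) ν :=
    integrable_of_continuous_compact ν ((hF.sub continuous_const).pow 2)
  have hcen : ∫ y, (F y - m) ∂ν = 0 := by
    rw [integral_sub hFi (integrable_const m), integral_const, smul_eq_mul, probReal_univ, one_mul,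
      ← hm, sub_self]
  set V : ℝ := ∫ y, (F y - m) ^ 2 ∂ν with hV
  -- the inner integral at fixed `y`
  have hinner : ∀ y, ∫ y', (F y - F y') ^ 2 ∂ν = (F y - m) ^ 2 + V := by
    intro y
    have e : ∀ y', (F y - F y') ^ 2 =
        (F y - m) ^ 2 - 2 * (F y - m) * (F y' - m) + (F y' - m) ^ 2 := by
      intro y'; ring
    simp_rw [e]
    have hi1 : Integrable (fun y' => (F y - m) ^ 2 - 2 * (F y - m) * (F y' - m)) ν :=
      (integrable_const _).sub (hcm.const_mul _)
    rw [integral_add hi1 hsq, integral_sub (integrable_const _) (hcm.const_mul _),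
      integral_const_mul, hcen, mul_zero, sub_zero, integral_const, smul_eq_mul, probReal_univ,
      one_mul]
  simp_rw [hinner]
  rw [integral_add hsq (integrable_const V), integral_const, smul_eq_mul, probReal_univ, one_mul]
  ring

/-- **`∫∫ |F(y) − F(y')| ≤ √(2·Var F)`** (continuous `F`; Cauchy–Schwarz on the pair space). -/
theorem integral_integral_abs_sub_le (hF : Continuous F) :
    ∫ y, ∫ y', |F y - F y'| ∂ν ∂ν ≤ Real.sqrt (2 * ∫ y, (F y - ∫ z, F z ∂ν) ^ 2 ∂ν) := by
  -- move to the product measure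
  have hHc : Continuous fun p : Y × Y => F p.1 - F p.2 :=
    (hF.comp continuous_fst).sub (hF.comp continuous_snd)
  have hHi : Integrable (fun p : Y × Y => F p.1 - F p.2) (ν.prod ν) :=
    hHc.integrable_of_hasCompactSupport (HasCompactSupport.of_compactSpace _)
  have hHa : Integrable (fun p : Y × Y => |F p.1 - F p.2|) (ν.prod ν) := hHi.abs
  have hH2 : Integrable (fun p : Y × Y => (F p.1 - F p.2) ^ 2) (ν.prod ν) :=
    (hHc.pow 2).integrable_of_hasCompactSupport (HasCompactSupport.of_compactSpace _)
  have h1 : ∫ y, ∫ y', |F y - F y'| ∂ν ∂ν = ∫ p, |F p.1 - F p.2| ∂(ν.prod ν) :=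
    (integral_prod (fun p : Y × Y => |F p.1 - F p.2|) hHa).symm
  have h2 : ∫ y, ∫ y', (F y - F y') ^ 2 ∂ν ∂ν = ∫ p, (F p.1 - F p.2) ^ 2 ∂(ν.prod ν) :=
    (integral_prod (fun p : Y × Y => (F p.1 - F p.2) ^ 2) hH2).symm
  have hcs := sq_integral_abs_le_integral_sq (ν := ν.prod ν) hHi hH2
  rw [← h2, integral_integral_sq_sub ν hF] at hcs
  rw [h1]
  have hnn : 0 ≤ ∫ p, |F p.1 - F p.2| ∂(ν.prod ν) := integral_nonneg fun p => abs_nonneg _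
  have h := Real.abs_le_sqrt hcs
  rwa [abs_of_nonneg hnn] at h

/-- **`∫∫ max(F(y), F(y')) = ∫F + ½·∫∫|F(y) − F(y')|`** (`max(a,b) = (a+b)/2 + |a−b|/2`). -/
theorem integral_integral_max_eq (hF : Continuous F) :
    ∫ y, ∫ y', max (F y) (F y') ∂ν ∂ν = (∫ z, F z ∂ν) + (1 / 2) * ∫ y, ∫ y', |F y - F y'| ∂ν ∂ν := by
  have hFi : Integrable F ν := integrable_of_continuous_compact ν hF
  have habs : ∀ y, Integrable (fun y' => |F y - F y'|) ν := fun y =>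
    integrable_of_continuous_compact ν ((continuous_const.sub hF).abs)
  have hinner : ∀ y, ∫ y', max (F y) (F y') ∂ν =
      (1 / 2) * F y + (1 / 2) * (∫ z, F z ∂ν) + (1 / 2) * ∫ y', |F y - F y'| ∂ν := by
    intro y
    have e : ∀ y', max (F y) (F y') = ((1 / 2) * F y + (1 / 2) * F y') + (1 / 2) * |F y - F y'| := by
      intro y'
      rw [max_def]
      split_ifs with h
      · rw [abs_of_nonpos (sub_nonpos.2 h)]; ring
      · rw [abs_of_pos (sub_pos.2 (lt_of_not_ge h))]; ring
    simp_rw [e]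
    have hiF : Integrable (fun y' => (1 / 2) * F y') ν := hFi.const_mul _
    have hiA : Integrable (fun y' => (1 / 2) * F y + (1 / 2) * F y') ν := (integrable_const _).add hiF
    have hiB : Integrable (fun y' => (1 / 2) * |F y - F y'|) ν := (habs y).const_mul _
    rw [integral_add hiA hiB, integral_add (integrable_const _) hiF, integral_const_mul,
      integral_const_mul, integral_const_mul, integral_const, smul_eq_mul, probReal_univ, one_mul]
  simp_rw [hinner]
  have hI : Integrable (fun y => ∫ y', |F y - F y'| ∂ν) ν := by
    have hc : Continuous fun y => ∫ y', |F y - F y'| ∂ν := by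
      have hf : Continuous (uncurry fun (y : Y) (y' : Y) => |F y - F y'|) :=
        ((hF.comp continuous_fst).sub (hF.comp continuous_snd)).abs
      have h := continuous_parametric_integral_of_continuous (μ := ν) hf isCompact_univ
      simp only [Measure.restrict_univ] at h
      exact h
    exact integrable_of_continuous_compact ν hc
  have hiF' : Integrable (fun y => (1 / 2) * F y) ν := hFi.const_mul _
  have hiC : Integrable (fun y => (1 / 2) * F y + (1 / 2) * ∫ z, F z ∂ν) ν := hiF'.add (integrable_const _)
  have hiD : Integrable (fun y => (1 / 2) * ∫ y', |F y - F y'| ∂ν) ν := hI.const_mul _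
  rw [integral_add hiC hiD, integral_add hiF' (integrable_const _), integral_const_mul,
    integral_const_mul, integral_const_mul, integral_const, smul_eq_mul, probReal_univ, one_mul]
  ring

/-- **JENSEN ON THE PAIR SPACE**: `∫∫ e^{−max(F(y),F(y'))} ≥ exp(−(∫F + ½∫∫|F(y) − F(y')|))`. -/
theorem exp_neg_le_integral_integral_exp_neg_max (hF : Continuous F) :
    Real.exp (-((∫ z, F z ∂ν) + (1 / 2) * ∫ y, ∫ y', |F y - F y'| ∂ν ∂ν)) ≤
      ∫ y, ∫ y', Real.exp (-max (F y) (F y')) ∂ν ∂ν := by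
  have hMc : Continuous fun p : Y × Y => max (F p.1) (F p.2) :=
    (hF.comp continuous_fst).max (hF.comp continuous_snd)
  have hMi : Integrable (fun p : Y × Y => max (F p.1) (F p.2)) (ν.prod ν) :=
    hMc.integrable_of_hasCompactSupport (HasCompactSupport.of_compactSpace _)
  have hEi : Integrable (fun p : Y × Y => Real.exp (-max (F p.1) (F p.2))) (ν.prod ν) :=
    (Real.continuous_exp.comp hMc.neg).integrable_of_hasCompactSupport
      (HasCompactSupport.of_compactSpace _)
  have h1 : ∫ y, ∫ y', max (F y) (F y') ∂ν ∂ν = ∫ p, max (F p.1) (F p.2) ∂(ν.prod ν) :=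
    (integral_prod (fun p : Y × Y => max (F p.1) (F p.2)) hMi).symm
  have h2 : ∫ y, ∫ y', Real.exp (-max (F y) (F y')) ∂ν ∂ν =
      ∫ p, Real.exp (-max (F p.1) (F p.2)) ∂(ν.prod ν) :=
    (integral_prod (fun p : Y × Y => Real.exp (-max (F p.1) (F p.2))) hEi).symm
  have hMn : Integrable (fun p : Y × Y => -max (F p.1) (F p.2)) (ν.prod ν) := hMi.neg
  have hJ := exp_integral_le_integral_exp (ν := ν.prod ν) hMn hEi
  rw [integral_neg] at hJ
  rw [← integral_integral_max_eq ν hF, h1, h2]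
  exact hJ

end Pair

/-! ## §3 The mean acceptance of the flow-based independence sampler -/

section Acceptance

variable {Λ : Type*} {E : Type*} [NormedAddCommGroup E] [InnerProductSpace ℝ E]
  [FiniteDimensional ℝ E] [Fintype Λ] [DecidableEq Λ] [MeasurableSpace E] [BorelSpace E] [Nontrivial E]

omit [DecidableEq Λ] [Nontrivial E] in
/-- **THE MEAN ACCEPTANCE IN CLOSED FORM**: for every `F` on `Ω`,
`∫ (∫ min(1, e^{F(ω) − F(ω')}) dπ̄(ω')) d(π̄.tilted(−F))(ω) = (∫∫ e^{−max(F(ω),F(ω'))} dπ̄ dπ̄)/(∫ e^{−F} dπ̄)`. -/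
theorem indepSampler_meanAccept_eq (F : (Λ → sphere (0 : E) 1) → ℝ) :
    ∫ ω, (∫ ω', min 1 (Real.exp (F ω - F ω'))
        ∂Measure.pi (fun _ : Λ => uniformSphere (volume : Measure E)))
      ∂(Measure.pi (fun _ : Λ => uniformSphere (volume : Measure E))).tilted (fun ω => -F ω) =
      (∫ ω, ∫ ω', Real.exp (-max (F ω) (F ω'))
          ∂Measure.pi (fun _ : Λ => uniformSphere (volume : Measure E))
          ∂Measure.pi (fun _ : Λ => uniformSphere (volume : Measure E))) /
        ∫ ω, Real.exp (-F ω) ∂Measure.pi (fun _ : Λ => uniformSphere (volume : Measure E)) := by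
  rw [integral_spherePi_tilted]
  congr 1
  refine integral_congr_ae (ae_of_all _ fun ω => ?_)
  simp only
  rw [← integral_const_mul]
  refine integral_congr_ae (ae_of_all _ fun ω' => ?_)
  simp only
  -- `e^{−F ω} · min(1, e^{F ω − F ω'}) = e^{−max(F ω, F ω')}`
  rw [mul_min_of_nonneg _ _ (Real.exp_pos _).le, mul_one, ← Real.exp_add,
    show -F ω + (F ω - F ω') = -F ω' by ring, max_def]
  split_ifs with h
  · rw [min_eq_right (Real.exp_le_exp.2 (neg_le_neg h))]
  · rw [min_eq_left (Real.exp_le_exp.2 (neg_le_neg (le_of_not_ge h)))]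

omit [DecidableEq Λ] in
/-- **ACCEPTANCE FROM CONCENTRATION OF THE LOG-WEIGHTS.**  For every continuous `F` on `Ω` with
`∫ e^{−(F − ∫F)} dπ̄ ≤ e^{a}` and `∫ (F − ∫F)² dπ̄ ≤ v`, the mean acceptance of the independence
sampler (target `π̄.tilted(−F)`, proposal `π̄`) is at least `exp(−(a + √(v/2)))`. -/
theorem exp_neg_le_meanAccept_of_mgf_of_variance {F : (Λ → sphere (0 : E) 1) → ℝ}
    (hF : Continuous F) {a v : ℝ}
    (hmgf : ∫ ω, Real.exp (-(F ω - ∫ ω', F ω' ∂Measure.pi (fun _ : Λ => uniformSphere (volume : Measure E))))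
        ∂Measure.pi (fun _ : Λ => uniformSphere (volume : Measure E)) ≤ Real.exp a)
    (hvar : ∫ ω, (F ω - ∫ ω', F ω' ∂Measure.pi (fun _ : Λ => uniformSphere (volume : Measure E))) ^ 2
        ∂Measure.pi (fun _ : Λ => uniformSphere (volume : Measure E)) ≤ v) :
    Real.exp (-(a + Real.sqrt (v / 2))) ≤
      ∫ ω, (∫ ω', min 1 (Real.exp (F ω - F ω'))
          ∂Measure.pi (fun _ : Λ => uniformSphere (volume : Measure E)))
        ∂(Measure.pi (fun _ : Λ => uniformSphere (volume : Measure E))).tilted (fun ω => -F ω) := by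
  set μ : Measure (Λ → sphere (0 : E) 1) := Measure.pi (fun _ : Λ => uniformSphere (volume : Measure E))
    with hμ
  rw [indepSampler_meanAccept_eq F]
  set m : ℝ := ∫ ω', F ω' ∂μ with hm
  set I : ℝ := ∫ ω, ∫ ω', |F ω - F ω'| ∂μ ∂μ with hI
  have hFi : Integrable F μ := integrable_pi_of_continuous _ hF
  -- denominator: `∫ e^{−F} = e^{−m} ∫ e^{−(F − m)} ≤ e^{−m} e^{a}`
  have hZ : ∫ ω, Real.exp (-F ω) ∂μ ≤ Real.exp (-m) * Real.exp a := by
    have e : ∀ ω, Real.exp (-F ω) = Real.exp (-m) * Real.exp (-(F ω - m)) := by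
      intro ω; rw [← Real.exp_add]; congr 1; ring
    simp_rw [e]
    rw [integral_const_mul]
    exact mul_le_mul_of_nonneg_left hmgf (Real.exp_pos _).le
  have hZpos : 0 < ∫ ω, Real.exp (-F ω) ∂μ := by
    have hc : Continuous fun ω => Real.exp (-F ω) := Real.continuous_exp.comp hF.neg
    exact integral_exp_pos (integrable_pi_of_continuous _ hc)
  -- numerator: `≥ exp(−(m + I/2))` and `I ≤ √(2v)`
  have hN := exp_neg_le_integral_integral_exp_neg_max μ hF
  have hIle : I ≤ Real.sqrt (2 * v) := by
    refine (integral_integral_abs_sub_le μ hF).trans (Real.sqrt_le_sqrt ?_)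
    linarith
  have hsq : (1 / 2) * I ≤ Real.sqrt (v / 2) := by
    have hv : 0 ≤ v := le_trans (integral_nonneg fun ω => sq_nonneg _) hvar
    have h2 : Real.sqrt (2 * v) = 2 * Real.sqrt (v / 2) := by
      rw [show (2 : ℝ) * v = 2 ^ 2 * (v / 2) by ring, Real.sqrt_mul (by norm_num), Real.sqrt_sq (by norm_num)]
    rw [h2] at hIle
    linarith
  -- combine
  rw [le_div_iff₀ hZpos]
  calc Real.exp (-(a + Real.sqrt (v / 2))) * ∫ ω, Real.exp (-F ω) ∂μ
      ≤ Real.exp (-(a + Real.sqrt (v / 2))) * (Real.exp (-m) * Real.exp a) :=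
        mul_le_mul_of_nonneg_left hZ (Real.exp_pos _).le
    _ = Real.exp (-(m + Real.sqrt (v / 2))) := by
        rw [← Real.exp_add, ← Real.exp_add]; congr 1; ring
    _ ≤ Real.exp (-(m + (1 / 2) * I)) := Real.exp_le_exp.2 (by linarith)
    _ ≤ _ := hN

end Acceptance

end Summit.Ventures.LatticeQCDFlow.Exactness

end
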